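import Summits.NavierStokesRegularity.NavierStokesRegularity.Theorems.AxisTwistDoorAveragedConeLiouvilleNUWeakEnergyTools
import HarnessLib

/-!
# N4 / T1 piece W1, bricks B2–B3: continuity of the slice energy `M(t) = ∫ H(V(t,x))Θ(x)² dx`
# and the Steklov limits `h⁻¹∫_{]t,t+h[} f → f(t)`, `h⁻¹∫_{]t−h,t[} f → f(t)`

Route `AxisTwistDoor`, crux `AveragedConeLiouville` (stmt-NavierStokesRegularity-26889), INPUT N4 / T1,
programme `kits/N4-T1-skeleton.lean` (118454bf17607d1e), `kits/N4-T1-plan.md` v2 §7 bricks (B2), (B3):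
`continuousOn_sliceEnergy` (dominated convergence: `V` Lipschitz on the cylinder, `Θ` vanishing off
the unit ball), `tendsto_steklov_right`, `tendsto_steklov_left` (ε–δ from continuity at `t`).
Consumed by brick B5 (`h → 0⁺` in W1b `nu_weakEnergy_slab`).

WHAT THIS IS NOT: not a statement about Navier–Stokes; T1 is an INPUT; item 26889 and the summit
stay open. [folklore]
-/

noncomputable section

-- the summit and its single sub-problem share the name (CONVENTIONS §1)
set_option linter.dupNamespace false

open MeasureTheory Set Function Filter Topology Metric
open scoped NNReal ENNReal

namespace Summit.NavierStokesRegularity.NavierStokesRegularity.Theorems.AveragedConeLiouville.NUPositivity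

/-- **B2: the slice energy `t ↦ ∫ H(V(t,x))Θ(x)² dx` is continuous on `]0,T[`** for `V` Lipschitz on
the cylinder `]0,T[ × B(0,1)`, `H` continuous and `Θ` continuous vanishing off `B(0,1)`. [folklore] -/
theorem continuousOn_sliceEnergy {T : ℝ} {V : ℝ → EuclideanSpace ℝ (Fin 3) → ℝ}
    (hVlip : ∃ L, LipschitzOnWith L (uncurry V) (Ioo 0 T ×ˢ ball (0 : EuclideanSpace ℝ (Fin 3)) 1))
    {H : ℝ → ℝ} (hH : Continuous H) {Θ : EuclideanSpace ℝ (Fin 3) → ℝ} (hΘ : Continuous Θ)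
    (hΘ1 : ∀ x, x ∉ ball (0 : EuclideanSpace ℝ (Fin 3)) 1 → Θ x = 0) :
    ContinuousOn (fun t => ∫ x, H (V t x) * Θ x ^ 2) (Ioo 0 T) := by
  set W : Set (ℝ × EuclideanSpace ℝ (Fin 3)) := Ioo 0 T ×ˢ ball (0 : EuclideanSpace ℝ (Fin 3)) 1 with hW
  have hWc : IsCompact (Icc 0 T ×ˢ closedBall (0 : EuclideanSpace ℝ (Fin 3)) 1) :=
    isCompact_Icc.prod (isCompact_closedBall _ _)
  have hWsub : W ⊆ Icc 0 T ×ˢ closedBall (0 : EuclideanSpace ℝ (Fin 3)) 1 :=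
    Set.prod_mono Ioo_subset_Icc_self ball_subset_closedBall
  obtain ⟨L, hL⟩ := hVlip
  obtain ⟨g, hg, hVg⟩ := hL.extend_real
  obtain ⟨Mg, hMg⟩ := hWc.exists_bound_of_continuousOn hg.continuous.continuousOn
  obtain ⟨MH, hMH⟩ := isCompact_Icc.exists_bound_of_continuousOn (hH.continuousOn (s := Icc (-Mg) Mg))
  obtain ⟨BΘ, hBΘ⟩ := (isCompact_closedBall (0 : EuclideanSpace ℝ (Fin 3)) 1).exists_bound_of_continuousOn
    ((hΘ.pow 2).continuousOn)
  have hVc : ContinuousOn (uncurry V) W := hL.continuousOn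
  -- the integrand vanishes off the ball
  have hzero : ∀ t x, x ∉ ball (0 : EuclideanSpace ℝ (Fin 3)) 1 → H (V t x) * Θ x ^ 2 = 0 :=
    fun t x hx => by rw [hΘ1 x hx]; ring
  have hind : ∀ t, (fun x => H (V t x) * Θ x ^ 2) =
      (ball (0 : EuclideanSpace ℝ (Fin 3)) 1).indicator fun x => H (V t x) * Θ x ^ 2 := by
    intro t; funext x
    by_cases hx : x ∈ ball (0 : EuclideanSpace ℝ (Fin 3)) 1
    · rw [indicator_of_mem hx]
    · rw [indicator_of_notMem hx, hzero t x hx]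
  have hslice : ∀ t ∈ Ioo 0 T, ContinuousOn (fun x => H (V t x) * Θ x ^ 2)
      (ball (0 : EuclideanSpace ℝ (Fin 3)) 1) := by
    intro t ht
    have h1 : ContinuousOn (fun x : EuclideanSpace ℝ (Fin 3) => V t x) (ball 0 1) :=
      hVc.comp (Continuous.prodMk_right t).continuousOn fun x hx => ⟨ht, hx⟩
    exact (hH.comp_continuousOn h1).mul ((hΘ.pow 2).continuousOn)
  refine continuousOn_of_dominated (bound := (closedBall (0 : EuclideanSpace ℝ (Fin 3)) 1).indicator
    fun _ => max MH 0 * max BΘ 0) (fun t ht => ?_) (fun t ht => Eventually.of_forall fun x => ?_) ?_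
    (Eventually.of_forall fun x => ?_)
  · rw [hind t]
    exact (aestronglyMeasurable_indicator_iff measurableSet_ball).2
      ((hslice t ht).aestronglyMeasurable measurableSet_ball)
  · by_cases hx : x ∈ ball (0 : EuclideanSpace ℝ (Fin 3)) 1
    · have hp : (t, x) ∈ W := ⟨ht, hx⟩
      have hVgp : V t x = g (t, x) := hVg hp
      have hgI : g (t, x) ∈ Icc (-Mg) Mg :=
        abs_le.mp ((Real.norm_eq_abs _).symm.le.trans (hMg _ (hWsub hp)))
      rw [indicator_of_mem (ball_subset_closedBall hx), norm_mul, hVgp]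
      exact mul_le_mul ((hMH _ hgI).trans (le_max_left _ _))
        ((hBΘ x (ball_subset_closedBall hx)).trans (le_max_left _ _)) (norm_nonneg _)
        (le_max_right _ _)
    · rw [hzero t x hx, norm_zero]
      exact indicator_nonneg (fun _ _ => mul_nonneg (le_max_right _ _) (le_max_right _ _)) _
  · exact (integrable_indicator_iff measurableSet_closedBall).2
      (integrableOn_const (measure_closedBall_lt_top.ne))
  · by_cases hx : x ∈ ball (0 : EuclideanSpace ℝ (Fin 3)) 1
    · have h1 : ContinuousOn (fun t : ℝ => V t x) (Ioo 0 T) :=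
        hVc.comp (Continuous.prodMk_left x).continuousOn fun t ht => ⟨ht, hx⟩
      exact (hH.comp_continuousOn h1).mul continuousOn_const
    · have e : (fun t : ℝ => H (V t x) * Θ x ^ 2) = fun _ => 0 := funext fun t => hzero t x hx
      rw [e]; exact continuousOn_const

/-- **B3 (right): the Steklov mean `h⁻¹ ∫_{]t,t+h[} f` tends to `f t` as `h → 0⁺`** for `f`
continuous on an open interval around `t`. [folklore] -/
theorem tendsto_steklov_right {f : ℝ → ℝ} {a b t : ℝ} (hf : ContinuousOn f (Ioo a b))
    (ht : t ∈ Ioo a b) :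
    Tendsto (fun h : ℝ => h⁻¹ * ∫ s in Ioo t (t + h), f s) (𝓝[>] 0) (𝓝 (f t)) := by
  refine Metric.tendsto_nhdsWithin_nhds.2 fun ε hε => ?_
  obtain ⟨δ₁, hδ₁, hcont⟩ := Metric.continuousAt_iff.1 (hf.continuousAt (Ioo_mem_nhds ht.1 ht.2))
    (ε / 2) (half_pos hε)
  refine ⟨min δ₁ (b - t), lt_min hδ₁ (by linarith [ht.2]), fun h hh hhδ => ?_⟩
  have hh0 : 0 < h := hh
  rw [dist_zero_right, Real.norm_eq_abs, abs_of_pos hh0] at hhδ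
  have hh1 : h < δ₁ := hhδ.trans_le (min_le_left _ _)
  have hh2 : t + h < b := by linarith [hhδ.trans_le (min_le_right δ₁ (b - t))]
  have hsub : Icc t (t + h) ⊆ Ioo a b := fun s hs => ⟨ht.1.trans_le hs.1, hs.2.trans_lt hh2⟩
  have hfi : IntegrableOn f (Ioo t (t + h)) volume :=
    ((hf.mono hsub).integrableOn_Icc).mono_set Ioo_subset_Icc_self
  have hμ : volume.real (Ioo t (t + h)) = h := by
    rw [Real.volume_real_Ioo, max_eq_left (by linarith)]; ring
  have hdiff : (∫ s in Ioo t (t + h), f s) - h * f t = ∫ s in Ioo t (t + h), (f s - f t) := by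
    rw [integral_sub hfi (integrableOn_const ((measure_Ioo_lt_top (μ := (volume : Measure ℝ))).ne)), setIntegral_const, hμ,
      smul_eq_mul]
  have hpt : ∀ s ∈ Ioo t (t + h), ‖f s - f t‖ ≤ ε / 2 := fun s hs => by
    have : dist s t < δ₁ := by
      rw [Real.dist_eq, abs_of_nonneg (by linarith [hs.1])]; linarith [hs.2]
    rw [← dist_eq_norm]; exact le_of_lt (hcont this)
  have hbound : ‖∫ s in Ioo t (t + h), (f s - f t)‖ ≤ ε / 2 * h := by
    have := norm_setIntegral_le_of_norm_le_const (measure_Ioo_lt_top (μ := (volume : Measure ℝ))) hpt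
    rwa [hμ] at this
  rw [Real.dist_eq]
  have hkey : h⁻¹ * (∫ s in Ioo t (t + h), f s) - f t =
      h⁻¹ * ((∫ s in Ioo t (t + h), f s) - h * f t) := by
    field_simp
  rw [hkey, hdiff, abs_mul, abs_of_pos (inv_pos.2 hh0)]
  calc h⁻¹ * |∫ s in Ioo t (t + h), (f s - f t)| ≤ h⁻¹ * (ε / 2 * h) :=
        mul_le_mul_of_nonneg_left ((Real.norm_eq_abs _).symm.le.trans hbound) (inv_pos.2 hh0).le
    _ = ε / 2 := by field_simp
    _ < ε := half_lt_self hε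

/-- **B3 (left): the Steklov mean `h⁻¹ ∫_{]t−h,t[} f` tends to `f t` as `h → 0⁺`** for `f`
continuous on an open interval around `t`. [folklore] -/
theorem tendsto_steklov_left {f : ℝ → ℝ} {a b t : ℝ} (hf : ContinuousOn f (Ioo a b))
    (ht : t ∈ Ioo a b) :
    Tendsto (fun h : ℝ => h⁻¹ * ∫ s in Ioo (t - h) t, f s) (𝓝[>] 0) (𝓝 (f t)) := by
  refine Metric.tendsto_nhdsWithin_nhds.2 fun ε hε => ?_
  obtain ⟨δ₁, hδ₁, hcont⟩ := Metric.continuousAt_iff.1 (hf.continuousAt (Ioo_mem_nhds ht.1 ht.2))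
    (ε / 2) (half_pos hε)
  refine ⟨min δ₁ (t - a), lt_min hδ₁ (by linarith [ht.1]), fun h hh hhδ => ?_⟩
  have hh0 : 0 < h := hh
  rw [dist_zero_right, Real.norm_eq_abs, abs_of_pos hh0] at hhδ
  have hh1 : h < δ₁ := hhδ.trans_le (min_le_left _ _)
  have hh2 : a < t - h := by linarith [hhδ.trans_le (min_le_right δ₁ (t - a))]
  have hsub : Icc (t - h) t ⊆ Ioo a b := fun s hs => ⟨hh2.trans_le hs.1, hs.2.trans_lt ht.2⟩
  have hfi : IntegrableOn f (Ioo (t - h) t) volume :=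
    ((hf.mono hsub).integrableOn_Icc).mono_set Ioo_subset_Icc_self
  have hμ : volume.real (Ioo (t - h) t) = h := by
    rw [Real.volume_real_Ioo, max_eq_left (by linarith)]; ring
  have hdiff : (∫ s in Ioo (t - h) t, f s) - h * f t = ∫ s in Ioo (t - h) t, (f s - f t) := by
    rw [integral_sub hfi (integrableOn_const ((measure_Ioo_lt_top (μ := (volume : Measure ℝ))).ne)), setIntegral_const, hμ,
      smul_eq_mul]
  have hpt : ∀ s ∈ Ioo (t - h) t, ‖f s - f t‖ ≤ ε / 2 := fun s hs => by
    have : dist s t < δ₁ := by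
      rw [Real.dist_eq, abs_of_nonpos (by linarith [hs.2])]; linarith [hs.1]
    rw [← dist_eq_norm]; exact le_of_lt (hcont this)
  have hbound : ‖∫ s in Ioo (t - h) t, (f s - f t)‖ ≤ ε / 2 * h := by
    have := norm_setIntegral_le_of_norm_le_const (measure_Ioo_lt_top (μ := (volume : Measure ℝ))) hpt
    rwa [hμ] at this
  rw [Real.dist_eq]
  have hkey : h⁻¹ * (∫ s in Ioo (t - h) t, f s) - f t =
      h⁻¹ * ((∫ s in Ioo (t - h) t, f s) - h * f t) := by
    field_simp
  rw [hkey, hdiff, abs_mul, abs_of_pos (inv_pos.2 hh0)]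
  calc h⁻¹ * |∫ s in Ioo (t - h) t, (f s - f t)| ≤ h⁻¹ * (ε / 2 * h) :=
        mul_le_mul_of_nonneg_left ((Real.norm_eq_abs _).symm.le.trans hbound) (inv_pos.2 hh0).le
    _ = ε / 2 := by field_simp
    _ < ε := half_lt_self hε

end Summit.NavierStokesRegularity.NavierStokesRegularity.Theorems.AveragedConeLiouville.NUPositivity

end
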